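import Summits.ResolutionOfSingularities.ResolutionOfSingularities.Theorems.TameAbelianQuotientLU2
import HarnessLib

/-!
# TameAbelianQuotientLU (3/5) — the tame abelian quotient cell and THE LAW

Part 3 of the g26 node `TameAbelianQuotientLU` of the ROOT/RESIDUAL decomposition cell
`decomp-res` (lens 1, window (W-ab) of critic row 193); see the module docstring of
`Summits.ResolutionOfSingularities.ResolutionOfSingularities.Theorems.TameAbelianQuotientLU` (part 1/5) for the thesis, the law,
the residual R26, the cuts and the sources.  Problem side, sorry-free, hypothesis-free.

This part: the cell `TameAbelianEquivariantLUAbove k O` (over the tree's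
`TameQuotientLU.modelAbove`), the law `relLU_of_tameAbelianEquivariantLUAbove :
TameAbelianEquivariantLUAbove k O → RelLocalUniformization k K O` (kernel, hypothesis-free), and
the one binder `tameAbelianEquivariantLUAbove_of_tameEquivariantLUAbove` (the g25 cyclic cell is
inside the abelian cell, by name).
-/

noncomputable section

open IntermediateField Polynomial Literature.AlgebraicGeometry.Resolution IsLocalRing

namespace Summit.ResolutionOfSingularities.ResolutionOfSingularities.Theorems.TameAbelianQuotientLU

/-! ## Part B — the TAME ABELIAN QUOTIENT CELL of a place `(K, O)` over `k` and THE LAW -/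

section Law

open Summit.ResolutionOfSingularities.ResolutionOfSingularities.Theorems.TameQuotientLU

variable (k : Type) [Field k] {K : Type} [Field K] [Algebra k K]

/-- **The TAME ABELIAN QUOTIENT CELL of a place `(K, O)` over `k`** (TYPED, syntactic): there is
a finite Galois extension `K′ | K` (realised in `K̄`) with ABELIAN group `G` of exponent dividing
`ℓ`, `ℓ ∈ k×`, a primitive `ℓ`-th root of unity in `k` (tame Kummer situation `μ_ℓ ⊆ k`,
`|G| ∈ k×`), and a valuation ring `O′` of `K′` above `O` FIXED by every `g ∈ G` (`G = G_Z`)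
with residues in `k` (so `G` is its own inertia group and acts trivially on the residue field),
such that `G`-EQUIVARIANT RELATIVE LOCAL UNIFORMIZATION HOLDS UPSTAIRS OVER THE MODELS OF `K`:
every finitely generated birational model `R ⊆ O` of `K` over `k` lies in a `G`-STABLE finitely
generated model `R[t₀] ⊆ O′` of `K′` (`TameQuotientLU.modelAbove`, the tree's g25 currency) whose
local ring at the centre of `O′` is regular.  Inhabitants beyond the cyclic cell
`TameQuotientLU.TameEquivariantLUAbove` of g25: bicyclic Kummer tops `K′ = K(x₁^{1/ℓ}, x₂^{1/ℓ})`,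
`G = (ℤ/ℓ)²` acting diagonally (NODE-g26.md §1). (Sources: CossartPiltant2008, Lemma 9.4; CossartPiltant2019, Prop.
4.10; Kuhlmann2000, Sections 13-15.) -/
def TameAbelianEquivariantLUAbove (O : ValuationSubring K) : Prop :=
  ∃ K' : IntermediateField K (AlgebraicClosure K), FiniteDimensional K K' ∧ IsGalois K K' ∧
  (∀ g h : K' ≃ₐ[K] K', g * h = h * g) ∧
  ∃ ℓ : ℕ, 0 < ℓ ∧ (ℓ : k) ≠ 0 ∧ (∀ g : K' ≃ₐ[K] K', g ^ ℓ = 1) ∧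
  ∃ ζ : k, IsPrimitiveRoot ζ ℓ ∧
  ∃ O' : ValuationSubring K', O'.comap (algebraMap K K') = O ∧
    (∀ g : K' ≃ₐ[K] K', ∀ y : K', y ∈ O' ↔ g y ∈ O') ∧
    (∀ y ∈ O', ∃ c : k, y - algebraMap k K' c ∈ O'.nonunits) ∧
  ∀ R : Subalgebra k K, R.FG → IsFractionRing R K → R.toSubring ≤ O.toSubring →
    ∃ t₀ : Finset K', modelAbove k R K' t₀ ≤ O'.toSubring ∧
      (∀ g : K' ≃ₐ[K] K', ∀ y ∈ modelAbove k R K' t₀, g y ∈ modelAbove k R K' t₀) ∧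
      IsRegularLocalRing (locAtCentre (modelAbove k R K' t₀) O')

variable {k}

/-- In a finite Galois extension an element fixed by the whole group lies in the ground field.
[folklore] -/
theorem exists_algebraMap_eq_of_fixed_all {K' : Type} [Field K'] [Algebra K K']
    [FiniteDimensional K K'] [IsGalois K K'] {z : K'} (hz : ∀ g : K' ≃ₐ[K] K', g z = z) :
    ∃ x : K, algebraMap K K' x = z := by
  have hmem : z ∈ IntermediateField.fixedField (⊤ : Subgroup (K' ≃ₐ[K] K')) := by
    rw [IntermediateField.mem_fixedField_iff]
    intro g _
    exact hz g
  rw [IsGalois.fixedField_top, IntermediateField.mem_bot] at hmem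
  exact hmem

set_option maxHeartbeats 1600000 in
/-- **THE TAME ABELIAN QUOTIENT LAW (kernel, hypothesis-free): equivariant uniformization above a
tame ABELIAN top with `G = G_Z` COMES DOWN.**  Given a finitely generated model `R ⊆ O` of `K`,
let `R[t₀] ⊆ O′` be the `G`-stable regular model of the cell.  Enumerate `G = {τ₀, …, τ_{r-1}}`
(pairwise commuting, `τᵢ^ℓ = 1`).  The base `R` (read in `K′`) is finitely generated over `k`,
hence universally catenary, fixed by `G`, and contains `ℓ⁻¹, ζ`; every `τᵢ` is residually
trivial and `κ(O′) | k` is algebraic (residues in `k`).  The abelian model brick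
`exists_jointly_fixed_model_isRegularLocalRing` yields JOINTLY FIXED `t ⊆ O′` with `R[t]`
regular at the centre of `O′`; elements fixed by all of `G` lie in `K`
(`exists_algebraMap_eq_of_fixed_all`), so `R[t] = A ⊆ O` is a finitely generated `k`-subalgebra
of `K` containing `R`, whose local ring at the centre of `O = O′ ∩ K` is that of `R[t]` at the
centre of `O′` (transport along `K ↪ K′`, `IsLocalization.ringEquivOfRingEquiv`). (Sources: CossartPiltant2008,
Prop. 6.2 (2) and proof of Lemma 9.4 (HAL pp. 19, 28–29); CossartPiltant2019, Prop. 4.10; Kuhlmann2000, Sections 13-15.) -/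
theorem relLU_of_tameAbelianEquivariantLUAbove {O : ValuationSubring K}
    (h : TameAbelianEquivariantLUAbove k O) : RelLocalUniformization k K O := by
  classical
  intro R hRfg hRfrac hRO
  obtain ⟨K', hfin, hgal, habel, ℓ, hℓ, hℓk, hGℓ, ζ, hζ, O', hO'O, hGO', hκ', hLU⟩ := h
  obtain ⟨t₀, hT₀O, hGT₀, hreg⟩ := hLU R hRfg hRfrac hRO
  haveI := hfin
  haveI := hgal
  haveI := hreg
  have hfinj : Function.Injective (algebraMap K K' : K →+* K') := (algebraMap K K').injective
  -- (0) enumerate the Galois group `G = {τ 0, …, τ (r-1)}`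
  obtain ⟨r, ⟨en⟩⟩ := Finite.exists_equiv_fin (K' ≃ₐ[K] K')
  let τ : ℕ → K' ≃+* K' := fun i =>
    if hi : i < r then ((en.symm ⟨i, hi⟩ : K' ≃ₐ[K] K') : K' ≃+* K') else RingEquiv.refl K'
  have hτi : ∀ i (hi : i < r), τ i = ((en.symm ⟨i, hi⟩ : K' ≃ₐ[K] K') : K' ≃+* K') :=
    fun i hi => dif_pos hi
  have hτeq : ∀ i < r, ∃ g : K' ≃ₐ[K] K', τ i = (g : K' ≃+* K') := fun i hi => ⟨_, hτi i hi⟩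
  have hτapp : ∀ i < r, ∃ g : K' ≃ₐ[K] K', ∀ z, τ i z = g z := fun i hi => by
    obtain ⟨g, hg⟩ := hτeq i hi
    exact ⟨g, fun z => by rw [hg]; rfl⟩
  have hτg : ∀ g : K' ≃ₐ[K] K', ∃ i, i < r ∧ ∀ z, τ i z = g z := fun g =>
    ⟨(en g).val, (en g).isLt, fun z => by rw [hτi _ (en g).isLt, Fin.eta, Equiv.symm_apply_apply]; rfl⟩
  -- (1) membership in `O` and `v < 1` are read upstairs (`O = O′ ∩ K`)
  have hmemO : ∀ x : K, x ∈ O ↔ algebraMap K K' x ∈ O' := fun x => by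
    rw [← hO'O]
    rfl
  have hvalO : ∀ y : K, O.valuation y < 1 ↔ O'.valuation (algebraMap K K' y) < 1 := fun y => by
    rw [← valuation_comap_lt_one_iff O' (algebraMap K K' : K →+* K') y, hO'O]
  -- (2) `G` fixes `K` and `k`
  have hgf : ∀ (g : K' ≃ₐ[K] K') (x : K), g (algebraMap K K' x) = algebraMap K K' x :=
    fun g x => g.commutes x
  have hfk : ∀ c : k, algebraMap K K' (algebraMap k K c) = algebraMap k K' c := fun c =>
    (IsScalarTower.algebraMap_apply k K K' c).symm
  have hgk : ∀ (g : K' ≃ₐ[K] K') (c : k), g (algebraMap k K' c) = algebraMap k K' c := fun g c => by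
    rw [← hfk]
    exact hgf g _
  -- (3) the base `S = R` read in `K′`
  have hRS : ∀ x ∈ R, algebraMap K K' x ∈ R.toSubring.map (algebraMap K K' : K →+* K') :=
    fun x hx => Subring.mem_map.mpr ⟨x, hx, rfl⟩
  have hτS : ∀ i < r, ∀ s ∈ R.toSubring.map (algebraMap K K' : K →+* K'), τ i s = s := by
    intro i hi s hs
    obtain ⟨x, -, rfl⟩ := Subring.mem_map.mp hs
    obtain ⟨g, hg⟩ := hτapp i hi
    rw [hg]
    exact hgf g x
  haveI : Algebra.FiniteType k R := (Subalgebra.fg_iff_finiteType R).mp hRfg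
  have hSuc : IsUniversallyCatenaryRing (R.toSubring.map (algebraMap K K' : K →+* K')) :=
    (isUniversallyCatenaryRing_of_finiteType_field k R).of_surjective
      ((algebraMap K K' : K →+* K').restrict R (R.toSubring.map (algebraMap K K' : K →+* K')) hRS) (by
        rintro ⟨y, hy⟩
        obtain ⟨x, hx, rfl⟩ := Subring.mem_map.mp hy
        exact ⟨⟨x, hx⟩, rfl⟩)
  have hkS : ∀ c : k, algebraMap k K' c ∈ R.toSubring.map (algebraMap K K' : K →+* K') := fun c => by
    rw [← hfk]
    exact hRS _ (R.algebraMap_mem c)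
  let ψ : k →+* R.toSubring.map (algebraMap K K' : K →+* K') := (algebraMap k K').codRestrict _ hkS
  have hℓ0 : ℓ ≠ 0 := hℓ.ne'
  have hℓu : IsUnit ((ℓ : R.toSubring.map (algebraMap K K' : K →+* K'))) := by
    rw [← map_natCast ψ ℓ]
    exact (IsUnit.mk0 _ hℓk).map ψ
  have hζS : algebraMap k K' ζ ∈ R.toSubring.map (algebraMap K K' : K →+* K') := hkS ζ
  have hζℓ : (algebraMap k K' ζ) ^ ℓ = 1 := by
    rw [← map_pow, hζ.pow_eq_one, map_one]
  have hζu : ∀ j : ℕ, 0 < j → j < ℓ →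
      IsUnit ((⟨algebraMap k K' ζ, hζS⟩ : R.toSubring.map (algebraMap K K' : K →+* K')) ^ j - 1) := by
    intro j hj hjℓ
    have hne : ζ ^ j - 1 ≠ 0 := sub_ne_zero.mpr (hζ.pow_ne_one_of_pos_of_lt hj.ne' hjℓ)
    have hψζ : (⟨algebraMap k K' ζ, hζS⟩ : R.toSubring.map (algebraMap K K' : K →+* K')) = ψ ζ :=
      Subtype.ext rfl
    rw [hψζ, ← map_pow, ← map_one ψ, ← map_sub]
    exact (IsUnit.mk0 _ hne).map ψ
  -- (4) `G` fixes `O′`, is residually trivial, commutes, has exponent `ℓ`; `κ(O′) | k` algebraic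
  have hτO' : ∀ i < r, ∀ x ∈ O', τ i x ∈ O' := by
    intro i hi x hx
    obtain ⟨g, hg⟩ := hτapp i hi
    rw [hg x]
    exact (hGO' g x).mp hx
  have hτT₀ : ∀ i < r, ∀ x ∈ modelAbove k R K' t₀, τ i x ∈ modelAbove k R K' t₀ := by
    intro i hi x hx
    obtain ⟨g, hg⟩ := hτapp i hi
    rw [hg x]
    exact hGT₀ g x hx
  have hres : ∀ i < r, ∀ b ∈ locAtCentre (modelAbove k R K' t₀) O',
      O'.valuation (τ i b - b) < 1 := by
    intro i hi b hb
    obtain ⟨g, hg⟩ := hτapp i hi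
    rw [hg b]
    obtain ⟨c, hc⟩ := hκ' b (locAtCentre_le hT₀O hb)
    have h1 : O'.valuation (b - algebraMap k K' c) < 1 := (O'.mem_nonunits_iff).mp hc
    have h2 : O'.valuation (g (b - algebraMap k K' c)) < 1 :=
      valuation_map_lt_one_of_stable (hGO' g) h1
    have h3 : g b - b = g (b - algebraMap k K' c) - (b - algebraMap k K' c) := by
      rw [map_sub, hgk]
      ring
    rw [h3]
    exact lt_of_le_of_lt (Valuation.map_sub _ _ _) (max_lt h2 h1)
  have halg : ∀ z : O', ∃ q : Polynomial (R.toSubring.map (algebraMap K K' : K →+* K')),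
      (∃ i, IsUnit (q.coeff i)) ∧ O'.valuation (Polynomial.aeval (z : K') q) < 1 := by
    intro z
    obtain ⟨c, hc⟩ := hκ' z z.2
    refine ⟨X - C (ψ c), ⟨1, by simp⟩, ?_⟩
    have h1 : Polynomial.aeval (z : K') (X - C (ψ c) : Polynomial (R.toSubring.map
        (algebraMap K K' : K →+* K'))) = z - algebraMap k K' c := by
      rw [map_sub, aeval_X, aeval_C]
      rfl
    rw [h1]
    exact (O'.mem_nonunits_iff).mp hc
  have hτℓ : ∀ i < r, τ i ^ ℓ = 1 := by
    intro i hi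
    obtain ⟨g, hg⟩ := hτeq i hi
    rw [hg]
    exact toRingEquiv_pow_eq_one (hGℓ g)
  have hcomm : ∀ i < r, ∀ i' < r, ∀ z : K', τ i (τ i' z) = τ i' (τ i z) := by
    intro i hi i' hi' z
    obtain ⟨g, hg⟩ := hτapp i hi
    obtain ⟨g', hg'⟩ := hτapp i' hi'
    rw [hg', hg, hg, hg', ← AlgEquiv.mul_apply, habel g g', AlgEquiv.mul_apply]
  -- (5) the abelian toric descent step for models (Part A)
  obtain ⟨t, hτt, hTO, hTreg⟩ := exists_jointly_fixed_model_isRegularLocalRing O' τ r hτO'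
    (R.toSubring.map (algebraMap K K' : K →+* K')) hτS hSuc t₀ hT₀O hτT₀ hreg
    (IsRegularLocalRing.spanFinrank_maximalIdeal (R := locAtCentre (modelAbove k R K' t₀) O')).symm
    hres halg hℓ0 hτℓ hcomm hℓu (algebraMap k K' ζ) hζS hζℓ hζu
  -- (6) the jointly fixed generators lie in `K`: pull the model back to `K`
  have ht_sub : (t : Set K') ⊆ Set.range (algebraMap K K' : K →+* K') := by
    intro z hz
    refine exists_algebraMap_eq_of_fixed_all fun g => ?_
    obtain ⟨i, hi, hgi⟩ := hτg g
    rw [← hgi z]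
    exact hτt i hi z hz
  let tK : Finset K := t.preimage (algebraMap K K') (hfinj.injOn)
  have hftK : (algebraMap K K' : K →+* K') '' (tK : Set K) = (t : Set K') := by
    rw [Finset.coe_preimage]
    exact Set.image_preimage_eq_of_subset ht_sub
  obtain ⟨s₀, hs₀⟩ := hRfg
  let A₀ : Subalgebra k K := Algebra.adjoin k ((s₀ : Set K) ∪ (tK : Set K))
  have hRA₀ : R ≤ A₀ := by
    rw [← hs₀]
    exact Algebra.adjoin_mono Set.subset_union_left
  have hA₀fg : A₀.FG := ⟨s₀ ∪ tK, by rw [Finset.coe_union]⟩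
  have hRcl : R.toSubring = Subring.closure (Set.range (algebraMap k K) ∪ (s₀ : Set K)) := by
    rw [← hs₀]
    exact Algebra.adjoin_eq_ring_closure _
  have hA₀cl : A₀.toSubring =
      Subring.closure (Set.range (algebraMap k K) ∪ ((s₀ : Set K) ∪ (tK : Set K))) :=
    Algebra.adjoin_eq_ring_closure _
  have hT : A₀.toSubring.map (algebraMap K K' : K →+* K') =
      Subring.closure (((R.toSubring.map (algebraMap K K' : K →+* K')) : Set K') ∪ (t : Set K')) := by
    have e1 : ((R.toSubring.map (algebraMap K K' : K →+* K') : Subring K') : Set K') =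
        (Subring.closure ((algebraMap K K' : K →+* K') '' (Set.range (algebraMap k K) ∪ (s₀ : Set K))) :
          Set K') := by
      rw [hRcl, RingHom.map_closure]
    rw [hA₀cl, RingHom.map_closure, e1, Subring.closure_union, Subring.closure_eq, ← Subring.closure_union]
    simp only [Set.image_union, hftK, Set.union_assoc]
  have hA₀O : A₀.toSubring ≤ O.toSubring := by
    intro x hx
    have hfx : algebraMap K K' x ∈ A₀.toSubring.map (algebraMap K K' : K →+* K') :=
      Subring.mem_map.mpr ⟨x, hx, rfl⟩
    rw [hT] at hfx
    exact (hmemO x).mpr (hTO hfx)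
  refine ⟨A₀, hA₀O, hRA₀, hA₀fg, ?_⟩
  -- (7) transport of the local ring at the centre along `K ↪ K′`
  let g : A₀.toSubring ≃+*
      Subring.closure (((R.toSubring.map (algebraMap K K' : K →+* K')) : Set K') ∪ (t : Set K')) :=
    (A₀.toSubring.equivMapOfInjective (algebraMap K K' : K →+* K') hfinj).trans (RingEquiv.subringCongr hT)
  have hg : ∀ x : A₀.toSubring, ((g x : Subring.closure (((R.toSubring.map
      (algebraMap K K' : K →+* K')) : Set K') ∪ (t : Set K'))) : K') = algebraMap K K' x := fun _ => rfl
  set P : Ideal A₀.toSubring := Ideal.comap (Subring.inclusion hA₀O) (IsLocalRing.maximalIdeal O) with hP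
  set P' := subringCentre (Subring.closure (((R.toSubring.map (algebraMap K K' : K →+* K')) : Set K') ∪
    (t : Set K'))) O' hTO with hP'
  haveI hregP' : IsRegularLocalRing (Localization.AtPrime P') :=
    (isRegularLocalRing_locAtCentre_iff hTO).mp hTreg
  have hPP' : P = P'.comap g.toRingHom := by
    ext x
    simp only [hP, hP', Ideal.mem_comap, RingEquiv.toRingHom_eq_coe, RingHom.coe_coe,
      mem_subringCentre_iff]
    rw [ValuationSubring.valuation_lt_one_iff, hg]
    exact hvalO x
  have hmap : Submonoid.map g.toRingHom.toMonoidHom P.primeCompl = P'.primeCompl := by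
    ext y
    constructor
    · rintro ⟨x, hx, rfl⟩
      change g x ∉ P'
      have hx' : x ∉ P := hx
      rw [hPP', Ideal.mem_comap] at hx'
      exact hx'
    · intro hy
      have hy' : y ∉ P' := hy
      refine ⟨g.symm y, ?_, ?_⟩
      · change g.symm y ∉ P
        rw [hPP', Ideal.mem_comap]
        change ¬ g (g.symm y) ∈ P'
        rw [g.apply_symm_apply]
        exact hy'
      · change g (g.symm y) = y
        exact g.apply_symm_apply y
  exact IsRegularLocalRing.of_ringEquiv (R := Localization.AtPrime P')
    (IsLocalization.ringEquivOfRingEquiv (Localization.AtPrime P) (Localization.AtPrime P') g hmap).symm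

/-- **The cyclic cell of g25 is contained in the abelian cell** (BY NAME against the tree's
`TameQuotientLU.TameEquivariantLUAbove`; the «one binder» of the window): a cyclic top with
generator `σ` is an abelian top of exponent dividing `ℓ`, and `σ`-stability of `O′` and of the
models is `G`-stability. (Sources: CossartPiltant2008, Lemma 9.4.) -/
theorem tameAbelianEquivariantLUAbove_of_tameEquivariantLUAbove {O : ValuationSubring K}
    (h : TameEquivariantLUAbove k O) : TameAbelianEquivariantLUAbove k O := by
  obtain ⟨K', hfin, hgal, σ, hcyc, ℓ, hℓ, hℓk, hσℓ, ζ, hζ, O', hO'O, hσO', hκ', hLU⟩ := h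
  have hpowO' : ∀ (i : ℕ) (y : K'), y ∈ O' ↔ (σ ^ i) y ∈ O' := by
    intro i
    induction i with
    | zero => intro y; rw [pow_zero, AlgEquiv.one_apply]
    | succ i ih => intro y; rw [pow_succ, AlgEquiv.mul_apply, hσO' y]; exact ih (σ y)
  have hpowT : ∀ (T : Subring K'), (∀ y ∈ T, σ y ∈ T) → ∀ (i : ℕ), ∀ y ∈ T, (σ ^ i) y ∈ T := by
    intro T hT i
    induction i with
    | zero => intro y hy; rw [pow_zero, AlgEquiv.one_apply]; exact hy
    | succ i ih => intro y hy; rw [pow_succ, AlgEquiv.mul_apply]; exact ih (σ y) (hT y hy)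
  refine ⟨K', hfin, hgal, ?_, ℓ, hℓ, hℓk, ?_, ζ, hζ, O', hO'O, ?_, hκ', ?_⟩
  · intro g h
    obtain ⟨i, rfl⟩ := hcyc g
    obtain ⟨j, rfl⟩ := hcyc h
    rw [← pow_add, ← pow_add, add_comm]
  · intro g
    obtain ⟨i, rfl⟩ := hcyc g
    rw [← pow_mul, mul_comm, pow_mul, hσℓ, one_pow]
  · intro g y
    obtain ⟨i, rfl⟩ := hcyc g
    exact hpowO' i y
  · intro R hRfg hRfrac hRO
    obtain ⟨t₀, hT₀O, hσT₀, hreg⟩ := hLU R hRfg hRfrac hRO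
    refine ⟨t₀, hT₀O, fun g y hy => ?_, hreg⟩
    obtain ⟨i, rfl⟩ := hcyc g
    exact hpowT _ hσT₀ i y hy

/-- The «one binder» in contrapositive form: off the abelian cell ⇒ off the cyclic cell of g25.
[folklore] -/
theorem not_tameEquivariantLUAbove_of_not_abelian {O : ValuationSubring K}
    (h : ¬ TameAbelianEquivariantLUAbove k O) : ¬ TameEquivariantLUAbove k O :=
  fun hc => h (tameAbelianEquivariantLUAbove_of_tameEquivariantLUAbove hc)

/-- The cyclic law of g25 (`TameQuotientLU.relLU_of_tameEquivariantLUAbove`) re-derived as a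
COROLLARY of the abelian law. [folklore] -/
theorem relLU_of_tameEquivariantLUAbove' {O : ValuationSubring K}
    (h : TameEquivariantLUAbove k O) : RelLocalUniformization k K O :=
  relLU_of_tameAbelianEquivariantLUAbove (tameAbelianEquivariantLUAbove_of_tameEquivariantLUAbove h)

end Law

end Summit.ResolutionOfSingularities.ResolutionOfSingularities.Theorems.TameAbelianQuotientLU

end
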